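import Literature.Topology.FourManifolds.StablyParallelizableEven
import Literature.Topology.FourManifolds.ClosedMinusBallParallelizable
import HarnessLib

/-!
# A closed manifold framed outside a ball (or off a point): `Sq` into the top degree vanishes
# and the intersection form is even

Topic `Literature/Topology/FourManifolds`. A. Kosinski, *Differential Manifolds* (1993), Ch. X,
Prop. (3.1) (p. 205), evenness half, and Ch. IX §8 ("almost parallelizable" manifolds: `M ∖ pt`
is parallelizable); M. Kervaire, J. Milnor, *Groups of homotopy spheres I*, Ann. of Math. 77
(1963), §7 footnote pp. 528–529 and proof of Lemma 7.4 (p. 529: "Removing the interior of an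
imbedded disk"); J. Milnor, J. Stasheff, *Characteristic classes* (1974), §18 with Thm. 11.14 (the
Wu class of a `π`-manifold vanishes).

The tree proves (`IntersectionFormEven.lean`, `StablyParallelizableEven.lean`) that the closed
model `K ∪ cone(∂K)` of an s-parallelizable null-cobordism `K` of a homotopy sphere has vanishing
cup squares `Sq : Hᵖ(·; ℤ/2) → Hⁿ⁺¹(·; ℤ/2)`, `p + p = n + 1`, and that a closed smooth
`(n+1)`-manifold `X` is the closed model of `K = X ∖ i(B̊)` for any ball-removal datum
(`ClosedMinusBall.closedModelHomeomorph`). `StablyParallelizableEven.lean` feeds this with a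
framing of ALL of `TX`. This file records the sharper input the argument actually uses — a
framing of `TX` only OUTSIDE the removed ball ("almost parallelizable" in the sense of Kosinski
IX §8 / Kervaire–Milnor): everything is PROVED; no definition, no named fact (D-0026).

The parallelizability of `K` from a framing of `TX` over `X ∖ i(B̊)` or off one point is the
tree's `ClosedMinusBallParallelizable.lean` (`ClosedMinusBall.isParallelizable_of_hasTangentFramingAlong_compl_image`,
`ClosedMinusBall.exists_isParallelizable_K`; Kervaire–Milnor, proof of Lemma 7.4). Here:

* `steenrodSqLower_eq_zero_of_hasTangentFramingAlong_compl_ball`,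
  `cupProduct_self_eq_zero_of_hasTangentFramingAlong_compl_ball`,
  `isEven_intersectionForm_of_hasTangentFramingAlong_compl_ball` — **for `X` closed, connected,
  smooth of dimension `n + 1` (`n ≠ 0`) framed outside a removable ball: `Sq y = y ∪ y = 0` for
  every `y ∈ Hᵖ(X; ℤ/2)`, `p + p = n + 1`, and the intersection form of every `ℤ`-orientation is
  even** (Kervaire–Milnor's `Sq`-vanishing for the s-parallelizable `K`, transported along
  `closedModelHomeomorph` by naturality of `Sq`);
* `steenrodSqLower_eq_zero_of_hasTangentFramingAlong_compl_singleton`,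
  `cupProduct_self_eq_zero_of_hasTangentFramingAlong_compl_singleton`,
  `isEven_intersectionForm_of_hasTangentFramingAlong_compl_singleton` — the same for `TX` framed
  off one point `x₀` (Kosinski's almost parallelizable manifolds, IX Def. (8.1)).

Written for the fact seat of `Literature.AlgebraicGeometry.Surfaces.K3_even_intersectionForm`
(a K3 surface minus finitely many points is parallelizable: holomorphic symplectic trivialisation).

## References

* A. Kosinski, *Differential Manifolds*, Academic Press 1993, Ch. X Prop. (3.1) p. 205; Ch. IX §8.
  [Kosinski1993]
* M. Kervaire, J. Milnor, *Groups of homotopy spheres I*, Ann. of Math. 77 (1963), §7 footnote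
  pp. 528–529, proof of Lemma 7.4 (p. 529), proof of Lemma 2.3 (p. 506). [KervaireMilnorAnnals1963]
* J. Milnor, J. Stasheff, *Characteristic classes*, Princeton UP 1974, §18, Thm. 11.14.
  [MilnorStasheff1974]
-/

open scoped Manifold ContDiff Topology
open Set Function CategoryTheory
open Literature.AlgebraicTopology.SingularHomology

noncomputable section

namespace Literature.Topology.FourManifolds

variable {n : ℕ} {X : Type} [TopologicalSpace X] [T2Space X] [SecondCountableTopology X]
  [CompactSpace X] [ChartedSpace (EuclideanSpace ℝ (Fin (n + 1))) X] [IsManifold (𝓡 (n + 1)) ∞ X]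


/-! ### `Sq = 0` into the top degree, and evenness, for manifolds framed outside a ball -/

open SmaleHomologySpheres in
/-- **`Sq : Hᵖ(X; ℤ/2) → Hⁿ⁺¹(X; ℤ/2)` vanishes on a closed connected manifold framed outside a
ball.** For `X` closed, connected, smooth of dimension `n + 1` (`n ≠ 0`), a ball-removal datum `D`
and a framing of `TX` over `X ∖ i(B̊)`: `Sq y = 0` for every `y ∈ Hᵖ(X; ℤ/2)`, `p + p = n + 1`.
Proof: `K = X ∖ i(B̊)` is an s-parallelizable null-cobordism of the standard sphere
(`ClosedMinusBall.isParallelizable_of_hasTangentFramingAlong_compl_image`,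
`ClosedMinusBall.nullCobordism`), so `Sq` vanishes on its closed model (the tree's
`HomotopySphere.steenrodSqLower_closedModel_eq_zero`: framed tube, Pontryagin–Thom collapse,
stability of `Sq`), which is `X` (`ClosedMinusBall.closedModelHomeomorph`; naturality of `Sq`).
[cite: KervaireMilnorAnnals1963, §7, footnote pp. 528–529 and proof of Lemma 7.4 (p. 529)] [cite: MilnorStasheff1974, §18 and Thm. 11.14] [cite: Kosinski1993, Ch. X, Prop. (3.1) (p. 205)] -/
theorem steenrodSqLower_eq_zero_of_hasTangentFramingAlong_compl_ball [ConnectedSpace X] (hn : n ≠ 0)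
    {p : ℕ} (hp : p + p = n + 1) (D : BallRemovalData n (nullCobordismOfClosed n X).W)
    (hfr : HasTangentFramingAlong (𝓡 (n + 1)) X
      ((↑) : ((discX D '' Metric.ball 0 1)ᶜ : Set X) → X))
    (y : singularCohomology (ZMod 2) (ZMod 2) X p) : steenrodSqLower X p (n + 1) 0 y = 0 := by
  classical
  have hK : IsStablyParallelizable (𝓡∂ (n + 1)) D.K :=
    (ClosedMinusBall.isParallelizable_of_hasTangentFramingAlong_compl_image D hfr).isStablyParallelizable
  obtain ⟨o⟩ := isOrientable_sphere_holds n
  set e : ClosedModel n D.K ≃ₜ X := ClosedMinusBall.closedModelHomeomorph D with he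
  -- `y = (e⁻¹)^* (e^* y)` and `Sq` is natural
  have hy : y = singularCohomology.map (ZMod 2) (ZMod 2) (e.symm : C(X, ClosedModel n D.K)) p
      (singularCohomology.map (ZMod 2) (ZMod 2) (e : C(ClosedModel n D.K, X)) p y) := by
    rw [← singularCohomology.mapIso_inv, ← singularCohomology.mapIso_hom, ← ModuleCat.comp_apply,
      Iso.hom_inv_id, ModuleCat.id_apply]
  have h0 : ∀ y' : singularCohomology (ZMod 2) (ZMod 2) (ClosedModel n D.K) p,
      steenrodSqLower (ClosedModel n D.K) p (n + 1) 0 y' = 0 := fun y' =>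
    HomotopySphere.steenrodSqLower_closedModel_eq_zero hn hp (HomotopySphere.sphere o)
      (ClosedMinusBall.nullCobordism D) hK y'
  rw [hy, ← steenrodSqLower_map, h0, map_zero]

open SmaleHomologySpheres in
/-- **Cup squares vanish mod 2 on a closed connected manifold framed outside a ball**:
`y ∪ y = 0` for every `y ∈ Hᵖ(X; ℤ/2)`, `p + p = n + 1` (`Sq_0 = Sqᵖ` on `Hᵖ` is the cup
square). [cite: KervaireMilnorAnnals1963, §7, footnote pp. 528–529] [cite: MilnorStasheff1974, §18 and Thm. 11.14] -/
theorem cupProduct_self_eq_zero_of_hasTangentFramingAlong_compl_ball [ConnectedSpace X] (hn : n ≠ 0)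
    {p : ℕ} (hp : p + p = n + 1) (D : BallRemovalData n (nullCobordismOfClosed n X).W)
    (hfr : HasTangentFramingAlong (𝓡 (n + 1)) X
      ((↑) : ((discX D '' Metric.ball 0 1)ᶜ : Set X) → X))
    (y : singularCohomology (ZMod 2) (ZMod 2) X p) : cupProduct hp y y = 0 := by
  rw [← steenrodSqLower_zero_eq_cupProduct_self hp]
  exact steenrodSqLower_eq_zero_of_hasTangentFramingAlong_compl_ball hn hp D hfr y

open SmaleHomologySpheres in
/-- **The intersection form of a closed connected manifold framed outside a ball is even**, for
every `ℤ`-orientation `μ` (`k + k = n + 1`; `⟨a ∪ a, [X]⟩ ≡ ⟨Sq ā, [X]₂⟩ = 0`, Hatcher §3.E).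
The hypothesis is Kosinski's almost-parallelizability in framed form; for `U = univ` this is the
tree's `isEven_intersectionForm_of_isStablyParallelizable_of_closed`.
[cite: Kosinski1993, Ch. X, Prop. (3.1) (p. 205) and Ch. IX §8] [cite: KervaireMilnorAnnals1963, §7, footnote pp. 528–529] -/
theorem isEven_intersectionForm_of_hasTangentFramingAlong_compl_ball [ConnectedSpace X] (hn : n ≠ 0)
    {k : ℕ} (hk : k + k = n + 1) (D : BallRemovalData n (nullCobordismOfClosed n X).W)
    (hfr : HasTangentFramingAlong (𝓡 (n + 1)) X
      ((↑) : ((discX D '' Metric.ball 0 1)ᶜ : Set X) → X))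
    (μ : HomologicalOrientation ℤ X (n + 1)) : (intersectionForm hk μ).IsEven :=
  isEven_intersectionForm_of_steenrodSqLower_eq_zero hk μ fun y =>
    steenrodSqLower_eq_zero_of_hasTangentFramingAlong_compl_ball hn hk D hfr y

/-! ### Framed off a point (Kosinski's almost parallelizable manifolds) -/

open SmaleHomologySpheres in
/-- **`Sq` into the top degree vanishes on a closed connected manifold whose tangent bundle is
framed off one point** (Kosinski's almost parallelizable manifolds, IX Def. (8.1): `TX` trivial
over every proper subset, used through `X ∖ {x₀}`): `Sq y = 0` for all `y ∈ Hᵖ(X; ℤ/2)`,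
`p + p = n + 1`, `n ≠ 0` — remove a disc centred at `x₀` (`ClosedMinusBall.exists_isParallelizable_K`).
[cite: Kosinski1993, Ch. IX Def. (8.1) (p. 189) and Ch. X Prop. (3.1) (p. 205)] [cite: KervaireMilnorAnnals1963, §7, footnote pp. 528–529 and proof of Lemma 7.4 (p. 529)] -/
theorem steenrodSqLower_eq_zero_of_hasTangentFramingAlong_compl_singleton [ConnectedSpace X]
    (hn : n ≠ 0) {p : ℕ} (hp : p + p = n + 1) {x₀ : X}
    (hfr : HasTangentFramingAlong (𝓡 (n + 1)) X ((↑) : (({x₀} : Set X)ᶜ : Set X) → X))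
    (y : singularCohomology (ZMod 2) (ZMod 2) X p) : steenrodSqLower X p (n + 1) 0 y = 0 := by
  obtain ⟨D, hD0, -⟩ := ClosedMinusBall.exists_isParallelizable_K (n := n) hfr
  have hx₀ : x₀ ∈ discX D '' Metric.ball 0 1 := hD0 ▸ mem_image_of_mem _ (Metric.mem_ball_self one_pos)
  have hsub : (discX D '' Metric.ball 0 1)ᶜ ⊆ ({x₀} : Set X)ᶜ :=
    compl_subset_compl.2 (singleton_subset_iff.2 hx₀)
  exact steenrodSqLower_eq_zero_of_hasTangentFramingAlong_compl_ball hn hp D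
    (hfr.comp ⟨Set.inclusion hsub, continuous_inclusion hsub⟩) y

/-- **Cup squares vanish mod 2 on a closed connected manifold framed off a point.**
[cite: Kosinski1993, Ch. IX Def. (8.1) (p. 189) and Ch. X Prop. (3.1) (p. 205)] -/
theorem cupProduct_self_eq_zero_of_hasTangentFramingAlong_compl_singleton [ConnectedSpace X]
    (hn : n ≠ 0) {p : ℕ} (hp : p + p = n + 1) {x₀ : X}
    (hfr : HasTangentFramingAlong (𝓡 (n + 1)) X ((↑) : (({x₀} : Set X)ᶜ : Set X) → X))
    (y : singularCohomology (ZMod 2) (ZMod 2) X p) : cupProduct hp y y = 0 := by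
  rw [← steenrodSqLower_zero_eq_cupProduct_self hp]
  exact steenrodSqLower_eq_zero_of_hasTangentFramingAlong_compl_singleton hn hp hfr y

/-- **The intersection form of a closed connected almost parallelizable manifold is even**
(`TX` framed off one point; every `ℤ`-orientation; `k + k = n + 1`, `n ≠ 0`).
[cite: Kosinski1993, Ch. IX Def. (8.1) (p. 189) and Ch. X Prop. (3.1) (p. 205)] [cite: MilnorStasheff1974, §18 and Thm. 11.14] -/
theorem isEven_intersectionForm_of_hasTangentFramingAlong_compl_singleton [ConnectedSpace X]
    (hn : n ≠ 0) {k : ℕ} (hk : k + k = n + 1) {x₀ : X}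
    (hfr : HasTangentFramingAlong (𝓡 (n + 1)) X ((↑) : (({x₀} : Set X)ᶜ : Set X) → X))
    (μ : HomologicalOrientation ℤ X (n + 1)) : (intersectionForm hk μ).IsEven :=
  isEven_intersectionForm_of_steenrodSqLower_eq_zero hk μ fun y =>
    steenrodSqLower_eq_zero_of_hasTangentFramingAlong_compl_singleton hn hk hfr y

end Literature.Topology.FourManifolds

end
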